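import Literature.AnabelianGeometry.SemiGraphs.ArithBranchGeometricPartAt
import Literature.AnabelianGeometry.SemiGraphs.TemperedEdgeLikeCommensurable
import Literature.AnabelianGeometry.SemiGraphs.TemperedReconstructionReductionsProofs
import Literature.AnabelianGeometry.SemiGraphs.TemperedCompactInVerticialAtBridge
import HarnessLib

/-!
# [SemiAnbd] Thm 3.7 / §5: edge-like subgroups of `π₁^temp(𝒢)` are commensurably terminal

Mochizuki, *Semi-graphs of anabelioids*, Publ. RIMS **42** (2006) 221–322, Thm 3.7 (ii)–(iv)
pp. 40–41 and §5 p. 65 (the branch decomposition groups `Π^temp_{𝔊,b} ⊆ Π^temp_{𝔊,v}` of Thm 5.4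
"may be thought of as the commensurator in `Π^temp_{𝔊,v}` of `Π^temp_{𝔾,b}`"); the profinite
analogue in print is [CombGC] Prop 1.2 (ii) ("edge-like subgroups are commensurably terminal").
[cite: MochizukiSemiAnbd2006, Thm 3.7 (iii)(iv), pp. 40–41; §5, p. 65]

PROOF-ONLY file (abc-iut cell, L3 sub-DAG [SemiAnbd] Thm 5.4, seat abc-iut-w4-d040, piece (c0) of the
LEVEL-A programme; no definition, no new named fact).  Per the per-graph convention of L3-lead ruling
α4-3 every statement takes the hypothesis `CompactInVerticialAt 𝒢` (Thm 3.7 (iii) AT the one graph in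
play, abc-iut-w4-d075); the ∀-graph forms follow by `compactInVerticialAt_of_compactInVerticial`.

* `eq_of_commensurable_of_mem_edgeLikeSubgroupsAt` — per-graph twin of abc-iut-w4-d053's
  `eq_of_commensurable_of_mem_edgeLikeSubgroups` (commensurable edge-like subgroups are equal), proof
  ported verbatim with `hCV 𝒢 ↦ h`;
* `smul_eq_self_of_mem_commensurator_of_mem_edgeLikeSubgroupsAt` — `g ∈ C(L) ⇒ g L g⁻¹ = L`
  (`C(L) = N(L)`);
* **`commensurator_eq_of_mem_edgeLikeSubgroupsAt`** — `C(L) = L` for every edge-like `L` of a graph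
  of anabelioids.  PROOF: for `g ∈ C(L)`, `gLg⁻¹ = L`; the conjugates `gH₁g⁻¹`, `gH₂g⁻¹` of the two
  distinct verticial hosts `H₁ ≠ H₂` of `L` (abc-iut-w4-d040's `exists_two_hosts_of_mem_edgeLikeSubgroups`)
  are verticial and contain `L`, so by "precisely two" each is `H₁` or `H₂`.  If `g` fixes `Hᵢ` then
  `g ∈ C(Hᵢ) = Hᵢ` (verticial subgroups are commensurably terminal) and `g ∈ C(L) ∩ Hᵢ = L`.  Otherwise
  `g` SWAPS the two hosts; then `g` normalises `M := H₁ ∩ H₂ ⊇ L` and `g² ∈ M`, so `M ∪ gM` is a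
  COMPACT subgroup, hence inside a verticial `H₃ ⊇ M` — again `H₁` or `H₂` — and `g ∈ Hᵢ` fixes `Hᵢ`,
  contradicting the swap (no "edge inversions" in `π₁^temp`);
* `commensurator_eq_of_mem_edgeLikeSubgroups` — the ∀-graph form (hypothesis `CompactInVerticial`);
* `normalizer_eq_of_mem_edgeLikeSubgroupsAt` — hence also `N(L) = L`.

Nothing here takes a side on [IUTchIII] Cor. 3.12; typed ≠ proved.
-/

namespace Literature.AnabelianGeometry.SemiGraphs

namespace ProfiniteSemiGraph

open Topology
open scoped Pointwise

universe u

variable {𝒢 : ProfiniteSemiGraph.{u}}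

/-- **Commensurable edge-like subgroups of `π₁^temp(𝒢)` are equal**, AT ONE GRAPH: twin of
abc-iut-w4-d053's `eq_of_commensurable_of_mem_edgeLikeSubgroups` with `CompactInVerticialAt 𝒢` (Thm 3.7
(iii) at `𝒢`) in place of the ∀-graph `CompactInVerticial`; proof ported verbatim.
[cite: MochizukiSemiAnbd2006, Thm 3.7 (iii)(iv), pp. 40–41] -/
theorem eq_of_commensurable_of_mem_edgeLikeSubgroupsAt (h : CompactInVerticialAt 𝒢)
    (h𝒢 : 𝒢.Thm37Hypotheses) (hG : 𝒢.graph.IsGraph) (c : TemperedPiChart 𝒢) {e e' : 𝒢.graph.Edge}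
    {L L' : Subgroup c.G} (hL : L ∈ edgeLikeSubgroups c e) (hL' : L' ∈ edgeLikeSubgroups c e')
    (hc : Subgroup.Commensurable L L') : L = L' := by
  haveI := TemperedPiChart.t2Space c
  -- the compact nontrivial `K := L ∩ L'`
  have hKc : IsCompact ((L ⊓ L' : Subgroup c.G) : Set c.G) := by
    rw [Subgroup.coe_inf]
    exact (isCompact_of_mem_edgeLikeSubgroups c hL).inter_right
      (isCompact_of_mem_edgeLikeSubgroups c hL').isClosed
  have hKne : L ⊓ L' ≠ ⊥ := inf_ne_bot_of_commensurable_of_mem_edgeLikeSubgroups h𝒢 c hL hL' hc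
  -- branches presenting the two edges
  obtain ⟨b, -, -, hbe, -, -⟩ := 𝒢.graph.two_branches e
  obtain ⟨b', -, -, hb'e, -, -⟩ := 𝒢.graph.two_branches e'
  have hLb : L ∈ edgeLikeSubgroups c (𝒢.graph.edgeOf b) := by rw [hbe]; exact hL
  have hL'b : L' ∈ edgeLikeSubgroups c (𝒢.graph.edgeOf b') := by rw [hb'e]; exact hL'
  -- the two hosts of `L`, and one host of `L'`
  obtain ⟨u₁, u₂, H₁, H₂, hH₁, hH₂, h12, hLH₁, hLH₂⟩ :=
    exists_two_hosts_of_mem_edgeLikeSubgroups_of_isGraph h𝒢 hG c b hLb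
  obtain ⟨u₃, -, H₃, -, hH₃, -, -, hL'H₃, -⟩ :=
    exists_two_hosts_of_mem_edgeLikeSubgroups_of_isGraph h𝒢 hG c b' hL'b
  -- "precisely two": `H₃` is `H₁` or `H₂`
  obtain ⟨honly, -⟩ := (h h𝒢 c (L ⊓ L') hKc).2 hKne u₁ u₂ H₁ H₂ hH₁ hH₂ h12
    (inf_le_left.trans hLH₁) (inf_le_left.trans hLH₂)
  have hCC : Subgroup.Commensurable.commensurator L = Subgroup.Commensurable.commensurator L' := hc.eq
  -- with a common verticial host `H`: `L = C(L) ∩ H = C(L') ∩ H = L'`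
  have key : ∀ {w : 𝒢.graph.Vertex} {H : Subgroup c.G}, H ∈ verticialSubgroups c w → L ≤ H → L' ≤ H →
      L = L' := by
    intro w H hH hLH hL'H
    rw [← commensurator_inf_eq_of_edgeLike_le_verticialAt h h𝒢 hG c hLb hH hLH,
      ← commensurator_inf_eq_of_edgeLike_le_verticialAt h h𝒢 hG c hL'b hH hL'H, hCC]
  rcases honly u₃ H₃ hH₃ (inf_le_right.trans hL'H₃) with rfl | rfl
  · exact key hH₁ hLH₁ hL'H₃
  · exact key hH₂ hLH₂ hL'H₃

/-- **`C(L) ≤ N(L)` for an edge-like `L`**, at one graph: an element commensurating `L` normalises it,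
since `gLg⁻¹` is again edge-like (at the same edge) and commensurable edge-like subgroups are equal.
[cite: MochizukiSemiAnbd2006, Thm 3.7 (iii)(iv), pp. 40–41] -/
theorem smul_eq_self_of_mem_commensurator_of_mem_edgeLikeSubgroupsAt (h : CompactInVerticialAt 𝒢)
    (h𝒢 : 𝒢.Thm37Hypotheses) (hG : 𝒢.graph.IsGraph) (c : TemperedPiChart 𝒢) {e : 𝒢.graph.Edge}
    {L : Subgroup c.G} (hL : L ∈ edgeLikeSubgroups c e) {g : c.G}
    (hg : g ∈ Subgroup.Commensurable.commensurator L) : ConjAct.toConjAct g • L = L := by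
  rw [Subgroup.Commensurable.commensurator_mem_iff] at hg
  have hmem : ConjAct.toConjAct g • L ∈ edgeLikeSubgroups c e := conj_mem_edgeLikeSubgroups' c hL g
  exact eq_of_commensurable_of_mem_edgeLikeSubgroupsAt h h𝒢 hG c hmem hL hg

/-- **Edge-like subgroups of `π₁^temp(𝒢)` are commensurably terminal: `C(L) = L`** (`𝒢` a graph of
anabelioids under the hypotheses of Thm 3.7; modulo Thm 3.7 (iii) AT `𝒢`, `CompactInVerticialAt 𝒢`).
See the module docstring for the proof (hosts fixed or swapped; a swap would be an edge inversion,
excluded because `(H₁ ∩ H₂) ∪ g(H₁ ∩ H₂)` would be a compact subgroup in no verticial subgroup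
other than `H₁`, `H₂`). [cite: MochizukiSemiAnbd2006, Thm 3.7 (iii)(iv), pp. 40–41; §5, p. 65] -/
theorem commensurator_eq_of_mem_edgeLikeSubgroupsAt (h : CompactInVerticialAt 𝒢)
    (h𝒢 : 𝒢.Thm37Hypotheses) (hG : 𝒢.graph.IsGraph) (c : TemperedPiChart 𝒢) {e : 𝒢.graph.Edge}
    {L : Subgroup c.G} (hL : L ∈ edgeLikeSubgroups c e) :
    Subgroup.Commensurable.commensurator L = L := by
  classical
  haveI := TemperedPiChart.t2Space c
  refine le_antisymm (fun g hg => ?_) (le_commensurator_self L)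
  -- Step 1: `g` normalises `L`
  have hgL : ConjAct.toConjAct g • L = L :=
    smul_eq_self_of_mem_commensurator_of_mem_edgeLikeSubgroupsAt h h𝒢 hG c hL hg
  -- Step 2: the two hosts of `L`
  obtain ⟨b, -, -, hbe, -, -⟩ := 𝒢.graph.two_branches e
  have hLb : L ∈ edgeLikeSubgroups c (𝒢.graph.edgeOf b) := by rw [hbe]; exact hL
  obtain ⟨u₁, u₂, H₁, H₂, hH₁, hH₂, h12, hLH₁, hLH₂⟩ :=
    exists_two_hosts_of_mem_edgeLikeSubgroups_of_isGraph h𝒢 hG c b hLb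
  have hLc : IsCompact (L : Set c.G) := isCompact_of_mem_edgeLikeSubgroups c hL
  haveI hLinf := infinite_of_mem_edgeLikeSubgroups verticialInjective_holds h𝒢 c hL
  have hLne : L ≠ ⊥ := by
    intro hb
    rw [hb] at hLinf
    exact not_finite (⊥ : Subgroup c.G)
  -- "precisely two" for `C := L`
  obtain ⟨honly, -⟩ := (h h𝒢 c L hLc).2 hLne u₁ u₂ H₁ H₂ hH₁ hH₂ h12 hLH₁ hLH₂
  -- an element fixing a verticial host `H ⊇ L` lies in `C(H) = H`, hence in `C(L) ∩ H = L`
  have memH : ∀ {w : 𝒢.graph.Vertex} {H : Subgroup c.G} {x : c.G}, H ∈ verticialSubgroups c w →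
      ConjAct.toConjAct x • H = H → x ∈ H := by
    intro w H x hH hxH
    have hxC : x ∈ Subgroup.Commensurable.commensurator H := by
      rw [Subgroup.Commensurable.commensurator_mem_iff, hxH]
    rwa [commensurator_eq_of_mem_verticialSubgroups h𝒢 c hH] at hxC
  have key : ∀ {w : 𝒢.graph.Vertex} {H : Subgroup c.G}, H ∈ verticialSubgroups c w → L ≤ H →
      ConjAct.toConjAct g • H = H → g ∈ L := by
    intro w H hH hLH hgH
    rw [← commensurator_inf_eq_of_edgeLike_le_verticialAt h h𝒢 hG c hLb hH hLH]
    exact ⟨hg, memH hH hgH⟩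
  -- the conjugates `gHᵢg⁻¹` are verticial hosts of `L = gLg⁻¹`, hence among `H₁`, `H₂`
  have hle : ∀ {H : Subgroup c.G}, L ≤ H → L ≤ ConjAct.toConjAct g • H := by
    intro H hLH
    rw [← hgL]
    exact Subgroup.pointwise_smul_le_pointwise_smul_iff.mpr hLH
  have hgH₁ := honly u₁ _ (conj_mem_verticialSubgroups c hH₁ g) (hle hLH₁)
  have hgH₂ := honly u₂ _ (conj_mem_verticialSubgroups c hH₂ g) (hle hLH₂)
  change ConjAct.toConjAct g • H₁ = H₁ ∨ ConjAct.toConjAct g • H₁ = H₂ at hgH₁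
  change ConjAct.toConjAct g • H₂ = H₁ ∨ ConjAct.toConjAct g • H₂ = H₂ at hgH₂
  rcases hgH₁ with h₁ | h₁
  · exact key hH₁ hLH₁ h₁
  rcases hgH₂ with h₂ | h₂
  swap
  · exact key hH₂ hLH₂ h₂
  -- Step 3: the swap `gH₁g⁻¹ = H₂`, `gH₂g⁻¹ = H₁` is impossible (no edge inversion)
  exfalso
  set M : Subgroup c.G := H₁ ⊓ H₂ with hM
  have hgM : ConjAct.toConjAct g • M = M := by
    rw [hM, Subgroup.smul_inf, h₁, h₂, inf_comm]
  have hg2H₁ : ConjAct.toConjAct (g * g) • H₁ = H₁ := by rw [map_mul, mul_smul, h₁, h₂]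
  have hg2H₂ : ConjAct.toConjAct (g * g) • H₂ = H₂ := by rw [map_mul, mul_smul, h₂, h₁]
  have hg2M : g * g ∈ M := ⟨memH hH₁ hg2H₁, memH hH₂ hg2H₂⟩
  -- conjugation by `g^{±1}` preserves `M`
  have hconj : ∀ m ∈ M, g * m * g⁻¹ ∈ M := by
    intro m hm
    have hm' := Subgroup.smul_mem_pointwise_smul m (ConjAct.toConjAct g) M hm
    rwa [hgM, ConjAct.toConjAct_smul] at hm'
  have hconj' : ∀ m ∈ M, g⁻¹ * m * g ∈ M := by
    intro m hm
    have hm' : m ∈ ConjAct.toConjAct g • M := by rwa [hgM]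
    rwa [Subgroup.mem_pointwise_smul_iff_inv_smul_mem, ← ConjAct.toConjAct_inv,
      ConjAct.toConjAct_smul, inv_inv] at hm'
  -- the compact subgroup `K := M ∪ gM`
  have hMc : IsCompact (M : Set c.G) := by
    rw [hM, Subgroup.coe_inf]
    exact (isCompact_of_mem_verticialSubgroups c hH₁).inter_right
      (isCompact_of_mem_verticialSubgroups c hH₂).isClosed
  obtain ⟨K, hKcoe⟩ : ∃ K : Subgroup c.G, (K : Set c.G) = (M : Set c.G) ∪ (g * ·) '' (M : Set c.G) := by
    refine ⟨{ carrier := (M : Set c.G) ∪ (g * ·) '' (M : Set c.G)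
              one_mem' := Or.inl M.one_mem
              mul_mem' := ?_
              inv_mem' := ?_ }, rfl⟩
    · rintro x y (hx | ⟨a, ha, rfl⟩) (hy | ⟨a', ha', rfl⟩)
      · exact Or.inl (M.mul_mem hx hy)
      · refine Or.inr ⟨g⁻¹ * x * g * a', M.mul_mem (hconj' x hx) ha', ?_⟩
        show g * (g⁻¹ * x * g * a') = x * (g * a')
        group
      · refine Or.inr ⟨a * y, M.mul_mem ha hy, ?_⟩
        show g * (a * y) = g * a * y
        group
      · refine Or.inl ?_
        have : g * a * (g * a') = g * g * (g⁻¹ * a * g) * a' := by group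
        rw [this]
        exact M.mul_mem (M.mul_mem hg2M (hconj' a ha)) ha'
    · rintro x (hx | ⟨a, ha, rfl⟩)
      · exact Or.inl (M.inv_mem hx)
      · refine Or.inr ⟨(g * g)⁻¹ * (g * a⁻¹ * g⁻¹),
          M.mul_mem (M.inv_mem hg2M) (hconj a⁻¹ (M.inv_mem ha)), ?_⟩
        show g * ((g * g)⁻¹ * (g * a⁻¹ * g⁻¹)) = (g * a)⁻¹
        group
  have hKc : IsCompact (K : Set c.G) := by
    rw [hKcoe]
    exact hMc.union (hMc.image (continuous_const_mul g))
  have hMK : M ≤ K := fun x hx => by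
    rw [← SetLike.mem_coe, hKcoe]
    exact Or.inl hx
  have hgK : g ∈ K := by
    rw [← SetLike.mem_coe, hKcoe]
    exact Or.inr ⟨1, M.one_mem, mul_one g⟩
  -- `K` lies in a verticial `H₃`, which contains `M ⊇ L`, hence is `H₁` or `H₂`
  obtain ⟨u₃, H₃, hH₃, hKH₃⟩ := (h h𝒢 c K hKc).1
  have hLM : L ≤ M := le_inf hLH₁ hLH₂
  have hMne : M ≠ ⊥ := by
    intro hb
    rw [hb, le_bot_iff] at hLM
    exact hLne hLM
  have hM₁ : M ≤ H₁ := by rw [hM]; exact inf_le_left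
  have hM₂ : M ≤ H₂ := by rw [hM]; exact inf_le_right
  obtain ⟨honlyM, -⟩ := (h h𝒢 c M hMc).2 hMne u₁ u₂ H₁ H₂ hH₁ hH₂ h12 hM₁ hM₂
  -- `g ∈ K ≤ H₃ ∈ {H₁, H₂}` fixes that host, contradicting the swap (`H₁ ≠ H₂`)
  rcases honlyM u₃ H₃ hH₃ (hMK.trans hKH₃) with h3 | h3
  · exact h12 ((conjAct_smul_eq_self_of_mem (h3 ▸ hKH₃ hgK)).symm.trans h₁)
  · exact h12 (h₂.symm.trans (conjAct_smul_eq_self_of_mem (h3 ▸ hKH₃ hgK)))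

/-- **`C(L) = L` for edge-like `L`, ∀-graph form**: the same under the frozen named fact
`CompactInVerticial` (Thm 3.7 (iii) for all graphs). [cite: MochizukiSemiAnbd2006, Thm 3.7 (iii)(iv), pp. 40–41; §5, p. 65] -/
theorem commensurator_eq_of_mem_edgeLikeSubgroups (hCV : CompactInVerticial.{u})
    (h𝒢 : 𝒢.Thm37Hypotheses) (hG : 𝒢.graph.IsGraph) (c : TemperedPiChart 𝒢) {e : 𝒢.graph.Edge}
    {L : Subgroup c.G} (hL : L ∈ edgeLikeSubgroups c e) :
    Subgroup.Commensurable.commensurator L = L :=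
  commensurator_eq_of_mem_edgeLikeSubgroupsAt (compactInVerticialAt_of_compactInVerticial hCV 𝒢)
    h𝒢 hG c hL

/-- **`N(L) = L` for edge-like `L`** (normally terminal), at one graph: `L ≤ N(L) ≤ C(L) = L`.
[cite: MochizukiSemiAnbd2006, Thm 3.7 (iii)(iv), pp. 40–41; §5, p. 65] -/
theorem normalizer_eq_of_mem_edgeLikeSubgroupsAt (h : CompactInVerticialAt 𝒢)
    (h𝒢 : 𝒢.Thm37Hypotheses) (hG : 𝒢.graph.IsGraph) (c : TemperedPiChart 𝒢) {e : 𝒢.graph.Edge}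
    {L : Subgroup c.G} (hL : L ∈ edgeLikeSubgroups c e) : Subgroup.normalizer (L : Set c.G) = L := by
  refine le_antisymm (fun g hg => ?_) Subgroup.le_normalizer
  rw [← commensurator_eq_of_mem_edgeLikeSubgroupsAt h h𝒢 hG c hL,
    Subgroup.Commensurable.commensurator_mem_iff, Subgroup.conjAct_pointwise_smul_eq_self hg]

/-- **An element commensurating (equivalently: normalising) an edge-like `L` lies in `L`** — the
membership form used by the LEVEL-A consumers of [SemiAnbd] Thm 5.4 (for `g` with `gLg⁻¹ = L`).
[cite: MochizukiSemiAnbd2006, Thm 3.7 (iii)(iv), pp. 40–41; §5, p. 65] -/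
theorem mem_of_smul_eq_of_mem_edgeLikeSubgroupsAt (h : CompactInVerticialAt 𝒢)
    (h𝒢 : 𝒢.Thm37Hypotheses) (hG : 𝒢.graph.IsGraph) (c : TemperedPiChart 𝒢) {e : 𝒢.graph.Edge}
    {L : Subgroup c.G} (hL : L ∈ edgeLikeSubgroups c e) {g : c.G}
    (hg : ConjAct.toConjAct g • L = L) : g ∈ L := by
  rw [← normalizer_eq_of_mem_edgeLikeSubgroupsAt h h𝒢 hG c hL]
  exact Subgroup.conjAct_pointwise_smul_iff.mp hg

end ProfiniteSemiGraph

end Literature.AnabelianGeometry.SemiGraphs
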